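/-
Copyright (c) 2026. All rights reserved.
Released under Apache 2.0 license as described in the file LICENSE.
Authors: abc-iut cell — seat abc-iut-w4-d104 (gen 4): row «COR29-L-A-ENGAGE», part 3 — the junction of the
germ structure used for [AbsTopIII] Cor 2.9 with abc-iut-w6-d024's Cor 2.7 (e) group cut out by the
Aut-holomorphic structure (p437330 typed, `cor27eGermAutFromAutHol_holds` proved).
-/
import Literature.AnabelianGeometry.AbsoluteAnabelian.ArchimedeanReconstructionCor27fAtGermModelProofs
import Literature.AnabelianGeometry.AbsoluteAnabelian.ArchimedeanReconstructionOneParameterProofs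
import Literature.AnabelianGeometry.AbsoluteAnabelian.ArchimedeanReconstructionCor29GermEngaged
import HarnessLib

/-!
# [AbsTopIII] Cor 2.9's `L` IS Cor 2.7 (e)'s structure of `𝕏_v`, read in the Cor 2.8 (b) charts

S. Mochizuki, *Topics in absolute anabelian geometry III* (bib key `MochizukiAbsTopIII2015`), Cor 2.7 (d)(e)
pp.59–60, Cor 2.8 (b) pp.63–64, Cor 2.9 p.64 l.39–41 ("take the Aut-holomorphic space `𝕏` of Corollary 2.7 to
be the Aut-holomorphic space determined by `(X^top, 𝒜_X)` constructed in Corollary 2.8").  PROOF-ONLY file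
(no definitions); part 3 of row «COR29-L-A-ENGAGE» (L4-lead RULING #8g).

Part (L) (`…Cor29GermEngaged.lean`, p442131) proves Cor 2.9 for the genuine datum with
`L := planeStructure.comap (fun x ↦ e_x x)`, `𝒜_x = germAut (e_x x)` — Prop 2.6 (a)'s group of germs at the
chart image point of the NF-point `x`, transitions `germAutTrans`.  This file records, in the kernel, why that
`L` is the structure print prescribes:

* `isAutHolDisc_ball` — a chart ball `B(c, r) ⊆ ℂ` is a planar Aut-holomorphic disc (Riemann mapping for
  convex proper opens, abc-iut-L4-t7 `isAutHolDisc_of_convex`); by Cor 2.8 (b) (`𝒜_X(U_X) := f_U⁻¹ ∘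
  Aut^hol(U_v) ∘ f_U`) its Aut-holomorphic structure is that of `𝕏_v` on `e_x⁻¹(B)` read through
  `e_x = κ⁻¹ ∘ f_U` (conjugation carries `Aut^hol` to `Aut^hol`: abc-iut-w4-d104 `autHolv_map_homeoConj`, p438129);
* `NFCurveData.germs_A_eq_germAutFromAutHol` — at every point, the group `𝒜_x` of part (L)'s `L` EQUALS
  abc-iut-w6-d024's `germAutFromAutHol B (e_x x)`: the germ automorphisms compatible with the local additive
  structure, preserving orientations, and preserving the orthogonal frames OF Cor 2.7 (d) — frames read off
  the one-parameter subgroups of `Aut^hol(B)` ALONE (`Cor27eGermAutFromAutHol`, PROVED: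
  `cor27eGermAutFromAutHol_holds`, p-id of w6-d024's proofs file);
* `NFCurveData.germs_trans_mem_and_multiplier` — the transitions `trans x₁ x₂ = germAutTrans` of that `L`
  land in the Cor 2.7 (e) group of the target chart ball with the SAME multiplier (w6-d024's
  `Cor27f.germAutTrans_mem_transport`, "compatible isomorphisms `𝒜_p ⥲ 𝒜_{p'}`"), so the scalar
  isomorphisms `𝒜_x ∪ {0} ⥲ k_v` of Cor 2.9 (b) pinned in part (L) are isomorphisms of THESE groups;
* `NFCurveData.germs_A_eq_germAutFromAutHol_of_mem` — the same for ANY planar Aut-holomorphic disc `V ∋ e_x x`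
  (chart-independence: w6-d024's `Cor27f.mem_germAutFromAutHol_iff`).

HONEST SCOPE: germ MODEL level in the charts (the identification of the chart disc's `Aut^hol` with `𝒜_X(U_X)`
is Cor 2.8 (b)'s DEFINITION of `𝕏_v`; the chart package itself stays the named analytic hypothesis of
p436603); nothing here bears on the disputed [IUTchIII] Cor. 3.12; refereed pre-IUT material; typed ≠ endorsed.
-/

noncomputable section

namespace Literature.AnabelianGeometry.AbsoluteAnabelian

open _root_.Set _root_.Topology _root_.Filter _root_.Metric _root_.Function _root_.TopologicalSpace
open ArchimedeanReconstruction

/-- **A chart ball is a planar Aut-holomorphic disc**: `B(c, r) ⊆ ℂ`, `r > 0`, with the complex structure of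
an open subset of `ℂ`, is biholomorphic to the unit disc (convex, non-empty, bounded hence proper; abc-iut-L4-t7's
`isAutHolDisc_of_convex`). [cite: MochizukiAbsTopIII2015, Corollary 2.7 (d) p.59] -/
theorem isAutHolDisc_ball (c : ℂ) {r : ℝ} (hr : 0 < r) :
    IsAutHolDisc (⟨ball c r, isOpen_ball⟩ : Opens ℂ) := by
  refine isAutHolDisc_of_convex _ (convex_ball c r) ⟨c, mem_ball_self hr⟩ ?_
  intro h
  have hb : Bornology.IsBounded (univ : Set ℂ) := by
    have h' : (ball c r : Set ℂ) = univ := h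
    rw [← h']
    exact isBounded_ball
  exact (NormedSpace.unbounded_univ ℝ ℂ) hb

namespace ArchimedeanReconstruction

/-- **The group `𝒜_x` of part (L)'s `L` IS Cor 2.7 (e)'s group cut out by the Aut-holomorphic structure of the
chart ball**: for `L := planeStructure.comap (fun x ↦ e_x x)`, the carrier of `𝒜_x = germAut (e_x x)` equals
abc-iut-w6-d024's `germAutFromAutHol B(e_x x, r_x) (e_x x)` — germ automorphisms compatible with the local
additive structure, preserving orientations and the orthogonal frames of Cor 2.7 (d) read off `Aut^hol` of the
ball alone — by `cor27eGermAutFromAutHol_holds`. [cite: MochizukiAbsTopIII2015, Corollary 2.7 (e) p.60] -/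
theorem NFCurveData.germs_A_eq_germAutFromAutHol (D : NFCurveData) (e : D.Xtop → D.Xtop → ℂ)
    (r : D.Xtop → ℝ) (x : D.Xtop) (hr : 0 < r x) :
    ((germAut (e x x) : Subgroup (LocGerm (e x x))ˣ) : Set (LocGerm (e x x))ˣ) =
      germAutFromAutHol (⟨ball (e x x) (r x), isOpen_ball⟩ : Opens ℂ) ⟨e x x, mem_ball_self hr⟩ ∧
    (Cor29Model.planeStructure.comap (fun x : D.Xtop => e x x)).A x = germAut (e x x) :=
  ⟨(cor27eGermAutFromAutHol_holds _ (isAutHolDisc_ball (e x x) hr) ⟨e x x, mem_ball_self hr⟩).symm, rfl⟩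

/-- Chart-independence of the junction: the same holds for ANY planar Aut-holomorphic disc `V` containing the
chart image point (both groups are `{z ↦ e_x x + c (z − e_x x)}`: `mem_germAut_iff`, w6-d024's
`Cor27f.mem_germAutFromAutHol_iff`). [cite: MochizukiAbsTopIII2015, Corollary 2.7 (e) p.60] -/
theorem NFCurveData.germs_A_eq_germAutFromAutHol_of_mem (D : NFCurveData) (e : D.Xtop → D.Xtop → ℂ)
    (x : D.Xtop) {V : Opens ℂ} (hV : IsAutHolDisc V) (hx : e x x ∈ V) :
    ((germAut (e x x) : Subgroup (LocGerm (e x x))ˣ) : Set (LocGerm (e x x))ˣ) =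
      germAutFromAutHol V ⟨e x x, hx⟩ :=
  (cor27eGermAutFromAutHol_holds V hV ⟨e x x, hx⟩).symm

/-- **The transitions of part (L)'s `L` are Cor 2.7 (e)'s "compatible isomorphisms `𝒜_p ⥲ 𝒜_{p'}`"**: for
NF-points `x₁`, `x₂`, `trans x₁ x₂ = germAutTrans (e x₁ x₁) (e x₂ x₂)` carries `u ∈ 𝒜_{x₁}` INTO the Cor 2.7 (e)
group of the chart ball at `x₂` and preserves the multiplier (w6-d024's `Cor27f.germAutTrans_mem_transport`),
so the pinned scalar isomorphisms `(multiplier) ≫ κ^×` of Cor 2.9 (b) in part (L) are compatible with them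
(row b.r4, `NFCurveData.germs_trans_eq`). [cite: MochizukiAbsTopIII2015, Corollary 2.7 (e) p.60] -/
theorem NFCurveData.germs_trans_mem_and_multiplier (D : NFCurveData) (e : D.Xtop → D.Xtop → ℂ)
    (r : D.Xtop → ℝ) (x₁ x₂ : D.Xtop) (hr₁ : 0 < r x₁) (hr₂ : 0 < r x₂) (u : germAut (e x₁ x₁)) :
    (Cor29Model.planeStructure.comap (fun x : D.Xtop => e x x)).trans x₁ x₂ =
        germAutTrans (e x₁ x₁) (e x₂ x₂) ∧
      ((germAutTrans (e x₁ x₁) (e x₂ x₂) u : germAut (e x₂ x₂)) : (LocGerm (e x₂ x₂))ˣ) ∈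
        germAutFromAutHol (⟨ball (e x₂ x₂) (r x₂), isOpen_ball⟩ : Opens ℂ) ⟨e x₂ x₂, mem_ball_self hr₂⟩ ∧
      (germAutIsoUnits (e x₂ x₂)).symm (germAutTrans (e x₁ x₁) (e x₂ x₂) u) =
        (germAutIsoUnits (e x₁ x₁)).symm u :=
  ⟨rfl, Cor27f.germAutTrans_mem_transport
    (V := (⟨ball (e x₁ x₁) (r x₁), isOpen_ball⟩ : Opens ℂ))
    (V' := (⟨ball (e x₂ x₂) (r x₂), isOpen_ball⟩ : Opens ℂ)) (isAutHolDisc_ball (e x₂ x₂) hr₂)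
    ⟨e x₁ x₁, mem_ball_self hr₁⟩ ⟨e x₂ x₂, mem_ball_self hr₂⟩ u⟩

end ArchimedeanReconstruction

end Literature.AnabelianGeometry.AbsoluteAnabelian

end
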